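import Literature.AlgebraicTopology.SingularHomology.HomotopyAdditionProofs
import HarnessLib

/-!
# The join cube `I^{p+3} → Δ^{p+3} = [v₀, v₁] * [v₂, …, v_{p+3}]` and the cone chart of a simplex

Topic `Literature/AlgebraicTopology/SingularHomology`. Coordinates on the standard simplex adapted
to the *relative* homotopy addition theorem (Spanier, *Algebraic Topology* (1981), Ch. 7 §5,
Prop. 3, `Bₙ`; `RelativeHomotopyAdditionCone.lean`), built on the collapse
`κₙ : Iⁿ → Δⁿ` of `CubeSimplexCollapse.lean` (`CubeCollapse.collapse`, faces onto faces):

* `coneChart n : Iⁿ⁺¹ → Δⁿ⁺¹`, `z ↦ κₙ₊₁ (1 - z₀, z₁, …, zₙ)` — the collapse with its first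
  coordinate reversed, so that the *lid* `{z₀ = 1}` goes to the vertex `v₀` and the *free face*
  `{z₀ = 0}` onto the opposite facet: the cone `Δⁿ⁺¹ = v₀ * [v₁, …, vₙ₊₁]` read on the cube
  (`coe_coneChart`: coordinates `(z₀, (1 - z₀) κₙ(z₁, …))`); it maps `∂Iⁿ⁺¹` into `∂Δⁿ⁺¹`
  (`coneChart_mem_stdBoundary`) and the lid to `v₀` (`coneChart_apply_of_lid`);
* `joinCube p : I^{p+3} → Δ^{p+3}`,
  `(r, e, t) ↦ (r (1 - e), r e, (1 - r) κ_{p+1}(t))` — the join structure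
  `Δ^{p+3} = [v₀, v₁] * [v₂, …, v_{p+3}]` read on the cube `I_r × I_e × I^{p+1}`:
  the lid `{r = 1}` goes onto the edge `[v₀, v₁]` (`joinCube_apply_succ_succ_of_lid`), the free
  face `{r = 0}` onto the face `[v₂, …, v_{p+3}]` of codimension two
  (`joinCube_mem_stdSkel_of_free`), the faces `{e = 1}`, `{e = 0}` are the cone charts of the
  facets `δ₀`, `δ₁` (`joinCube_insertNth_one`), the faces `{t_k = 1}` are the join cubes of the
  facets `δ_{k+2}` (`joinCube_succ_insertNth_succ_succ_one`), the face `{t_{p+1} = 0}` is the join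
  cube of the last facet (`joinCube_succ_insertNth_last_zero`), the remaining faces `{t_k = 0}` and
  all points with two extreme coordinates among `e, t` go into the codimension-two skeleton
  (`joinCube_insertNth_succ_succ_zero_mem_stdSkel`, `joinCube_mem_stdSkel_of_two`), and the whole
  boundary of the cube goes into `∂Δ^{p+3}` (`joinCube_mem_stdBoundary`).

Composed with a singular simplex `τ : Δ^{p+3} → X` mapping the codimension-two skeleton into `A`,
the vertices to `a` and the edge `[v₀, v₁]` to `a`, the join cube is a *lidded cube*
(`Homotopy/RelativeLiddedCubes.lean`) whose side faces are the facets of `τ` read through cone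
charts (facets `0`, `1`) and join cubes (facets `≥ 2`); this is how the cubical homotopy addition
theorem is transported to the relative classes of the faces of a singular simplex. Everything here
is elementary coordinate bookkeeping, proved; `[folklore]`.

## References

* E. H. Spanier, *Algebraic Topology*, Springer (1981), Ch. 7 §5, Prop. 3 (p. 395). [Spanier1981]
* A. Hatcher, *Algebraic Topology*, CUP (2002), §4.1, pp. 340–343. [HatcherAT2002]
-/

noncomputable section

open Set Function
open scoped unitInterval
open Literature.AlgebraicTopology.Homotopy.CubeHAT (IsExtreme isExtreme_zero isExtreme_one)

namespace Literature.AlgebraicTopology.SingularHomology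

open CubeCollapse

/-! ### Coordinates of cofaces and of the collapse on a cone -/

/-- **The coordinates of `δ_J w` are those of `w` with a `0` inserted at `J`.** [folklore] -/
lemma coe_stdFace {n : ℕ} (J : Fin (n + 2)) (w : StdSimplex n) :
    ((stdFace J w : StdSimplex (n + 1)) : Fin (n + 2) → ℝ) = Fin.insertNth J 0 (w : Fin (n + 1) → ℝ) := by
  funext i
  cases i using Fin.succAboveCases J with
  | x => rw [stdFace_apply_self, Fin.insertNth_apply_same]
  | p l => rw [stdFace_apply_succAbove, Fin.insertNth_apply_succAbove]

/-- Two points of the simplex with the same coordinate function are equal. [folklore] -/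
lemma StdSimplex.ext_coe {n : ℕ} {z z' : StdSimplex n} (h : (z : Fin (n + 1) → ℝ) = z') : z = z' :=
  Subtype.ext h

/-- **The collapse in cone coordinates**: `κₙ₊₁ (s, t) = (1 - s, s κₙ(t))`. [folklore] -/
lemma coe_collapse_cons {n : ℕ} (s : I) (t : Fin n → I) :
    ((collapse (Fin.cons s t : Fin (n + 1) → I) : StdSimplex (n + 1)) : Fin (n + 2) → ℝ) =
      Fin.cons (1 - (s : ℝ)) (fun j => (s : ℝ) * (collapse t : Fin (n + 1) → ℝ) j) := by
  have h : (Fin.cons s t : Fin (n + 1) → I) = Fin.insertNth (α := fun _ => I) 0 s t :=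
    (Fin.insertNth_zero' s t).symm
  funext i
  rw [h]
  cases i using Fin.cases with
  | zero =>
    rw [Fin.cons_zero, collapse_apply, pp_insertNth, pp_insertNth]
    simp
  | succ j =>
    rw [Fin.cons_succ, collapse_apply, collapse_apply, pp_insertNth, pp_insertNth]
    simp [mul_sub]

/-! ### The cone chart -/

/-- Reversing the first coordinate of the cube: `(z₀, z') ↦ (1 - z₀, z')`. [folklore] -/
def flipZero {n : ℕ} (z : Fin (n + 1) → I) : Fin (n + 1) → I := Fin.cons (σ (z 0)) (Fin.tail z)

/-- `flipZero` is continuous. [folklore] -/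
lemma continuous_flipZero {n : ℕ} : Continuous (flipZero (n := n)) :=
  continuous_pi fun i => Fin.cases (by simp only [flipZero, Fin.cons_zero]; fun_prop)
    (fun k => by simp only [flipZero, Fin.cons_succ, Fin.tail]; fun_prop) i

/-- `flipZero` preserves the boundary of the cube. [folklore] -/
lemma flipZero_mem_boundary {n : ℕ} {z : Fin (n + 1) → I} (hz : z ∈ Cube.boundary (Fin (n + 1))) :
    flipZero z ∈ Cube.boundary (Fin (n + 1)) := by
  obtain ⟨i, hi⟩ := hz
  refine ⟨i, ?_⟩
  cases i using Fin.cases with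
  | zero =>
    simp only [flipZero, Fin.cons_zero]
    rcases hi with hi | hi
    · right; rw [hi]; exact unitInterval.symm_zero
    · left; rw [hi]; exact unitInterval.symm_one
  | succ j => simpa [flipZero, Fin.tail] using hi

/-- **The cone chart** `Iⁿ⁺¹ → Δⁿ⁺¹ = v₀ * [v₁, …, vₙ₊₁]`: the collapse with reversed first
coordinate, `z ↦ (z₀, (1 - z₀) κₙ(z₁, …, zₙ))` — lid `{z₀ = 1} ↦ v₀`, free face `{z₀ = 0} ↦ δ₀`.
[folklore] -/
def coneChart (n : ℕ) : C((Fin (n + 1) → I), StdSimplex (n + 1)) :=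
  ⟨fun z => collapse (flipZero z), continuous_collapse.comp continuous_flipZero⟩

/-- The coordinates of the cone chart. [folklore] -/
lemma coe_coneChart {n : ℕ} (z : Fin (n + 1) → I) :
    ((coneChart n z : StdSimplex (n + 1)) : Fin (n + 2) → ℝ) =
      Fin.cons (z 0 : ℝ) (fun j => (1 - (z 0 : ℝ)) * (collapse (Fin.tail z) : Fin (n + 1) → ℝ) j) := by
  show ((collapse (Fin.cons (σ (z 0)) (Fin.tail z) : Fin (n + 1) → I) : StdSimplex (n + 1)) :
    Fin (n + 2) → ℝ) = _
  rw [coe_collapse_cons, unitInterval.coe_symm_eq, sub_sub_cancel]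

/-- The cone chart maps `∂Iⁿ⁺¹` into `∂Δⁿ⁺¹`. [folklore] -/
lemma coneChart_mem_stdBoundary {n : ℕ} {z : Fin (n + 1) → I} (hz : z ∈ Cube.boundary (Fin (n + 1))) :
    coneChart n z ∈ stdBoundary (n + 1) :=
  collapse_mem_stdBoundary (flipZero_mem_boundary hz)

/-- On the lid `{z₀ = 1}` the cone chart is the vertex `v₀`. [folklore] -/
lemma coneChart_apply_of_lid {n : ℕ} {z : Fin (n + 1) → I} (hz : z 0 = 1) :
    coneChart n z = stdSimplex.vertex (S := ℝ) (0 : Fin (n + 2)) := by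
  apply StdSimplex.ext_coe
  rw [coe_coneChart, stdSimplex.vertex_coe, hz]
  funext i
  cases i using Fin.cases with
  | zero => simp
  | succ j => simp [Fin.succ_ne_zero]

/-! ### The join cube -/

variable {p : ℕ}

/-- The two trailing blocks of coordinates of the cube `I^{p+3} = I_r × I_e × I^{p+1}`. [folklore] -/
def tail₂ (y : Fin (p + 3) → I) : Fin (p + 1) → I := fun i => y i.succ.succ

/-- `tail₂` is continuous. [folklore] -/
lemma continuous_tail₂ : Continuous (tail₂ (p := p)) :=
  continuous_pi fun _ => continuous_apply _

/-- The coordinate function of the join cube: `(r (1 - e), r e, (1 - r) κ_{p+1}(t))`. [folklore] -/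
def joinCoord (y : Fin (p + 3) → I) : Fin (p + 4) → ℝ :=
  Fin.cons ((y 0 : ℝ) * (1 - y 1)) (Fin.cons ((y 0 : ℝ) * y 1)
    fun k => (1 - (y 0 : ℝ)) * (collapse (tail₂ y) : Fin (p + 2) → ℝ) k)

/-- `joinCoord y 0 = r (1 - e)`. [folklore] -/
@[simp] lemma joinCoord_zero (y : Fin (p + 3) → I) : joinCoord y 0 = (y 0 : ℝ) * (1 - y 1) := rfl

/-- `joinCoord y 1 = r e`. [folklore] -/
@[simp] lemma joinCoord_one (y : Fin (p + 3) → I) : joinCoord y 1 = (y 0 : ℝ) * y 1 := rfl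

/-- `joinCoord y 1 = r e` (index written `Fin.succ 0`). [folklore] -/
@[simp] lemma joinCoord_succ_zero (y : Fin (p + 3) → I) :
    joinCoord y (Fin.succ 0) = (y 0 : ℝ) * y 1 := rfl

/-- `joinCoord y (k + 2) = (1 - r) κ(t)ₖ`. [folklore] -/
@[simp] lemma joinCoord_succ_succ (y : Fin (p + 3) → I) (k : Fin (p + 2)) :
    joinCoord y k.succ.succ = (1 - (y 0 : ℝ)) * (collapse (tail₂ y) : Fin (p + 2) → ℝ) k := rfl

/-- The join coordinates are non-negative. [folklore] -/
lemma joinCoord_nonneg (y : Fin (p + 3) → I) (i : Fin (p + 4)) : 0 ≤ joinCoord y i := by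
  cases i using Fin.cases with
  | zero => rw [joinCoord_zero]; exact mul_nonneg (y 0).2.1 (sub_nonneg.2 (y 1).2.2)
  | succ j =>
    cases j using Fin.cases with
    | zero => exact mul_nonneg (y 0).2.1 (y 1).2.1
    | succ k =>
      rw [joinCoord_succ_succ]
      exact mul_nonneg (sub_nonneg.2 (y 0).2.2) ((collapse (tail₂ y)).2.1 k)

/-- The join coordinates sum to `1`. [folklore] -/
lemma sum_joinCoord (y : Fin (p + 3) → I) : ∑ i, joinCoord y i = 1 := by
  have hs : ∑ i, (collapse (tail₂ y) : Fin (p + 2) → ℝ) i = 1 := (collapse (tail₂ y)).2.2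
  rw [Fin.sum_univ_succ, Fin.sum_univ_succ]
  simp only [joinCoord_zero, joinCoord_succ_zero, joinCoord_succ_succ]
  rw [← Finset.mul_sum, hs]
  ring

/-- The join coordinates depend continuously on the point of the cube. [folklore] -/
lemma continuous_joinCoord : Continuous (joinCoord (p := p)) := by
  refine continuous_pi fun i => ?_
  cases i using Fin.cases with
  | zero => simp only [joinCoord_zero]; fun_prop
  | succ j =>
    cases j using Fin.cases with
    | zero => simp only [joinCoord, Fin.cons_succ, Fin.cons_zero]; fun_prop
    | succ k =>
      simp only [joinCoord_succ_succ]
      refine Continuous.mul (by fun_prop) ?_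
      exact (continuous_apply k).comp (continuous_subtype_val.comp
        (continuous_collapse.comp continuous_tail₂))

variable (p) in
/-- **The join cube** `I^{p+3} → Δ^{p+3} = [v₀, v₁] * [v₂, …, v_{p+3}]`,
`(r, e, t) ↦ (r (1 - e), r e, (1 - r) κ_{p+1}(t))`. [folklore] -/
def joinCube : C((Fin (p + 3) → I), StdSimplex (p + 3)) :=
  ⟨fun y => ⟨joinCoord y, fun i => joinCoord_nonneg y i, sum_joinCoord y⟩,
    Continuous.subtype_mk continuous_joinCoord _⟩

/-- The coordinates of the join cube. [folklore] -/
@[simp] lemma coe_joinCube (y : Fin (p + 3) → I) :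
    ((joinCube p y : StdSimplex (p + 3)) : Fin (p + 4) → ℝ) = joinCoord y := rfl

/-! ### The side faces of the join cube -/

/-- A point of `I^{p+3}` in block form. [folklore] -/
lemma eq_cons_cons_tail₂ (y : Fin (p + 3) → I) : y = Fin.cons (y 0) (Fin.cons (y 1) (tail₂ y)) := by
  funext i
  cases i using Fin.cases with
  | zero => rfl
  | succ j =>
    cases j using Fin.cases with
    | zero => rfl
    | succ k => rfl

/-- The join coordinates in block form. [folklore] -/
lemma joinCoord_cons_cons (r e : I) (t : Fin (p + 1) → I) :
    joinCoord (Fin.cons r (Fin.cons e t) : Fin (p + 3) → I) =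
      Fin.cons ((r : ℝ) * (1 - e)) (Fin.cons ((r : ℝ) * e)
        fun k => (1 - (r : ℝ)) * (collapse t : Fin (p + 2) → ℝ) k) := rfl

/-- **The faces `{e = ε}`, `ε = 1, 0`, of the join cube are the cone charts of the facets `δ₀`,
`δ₁`**: `joinCube (r, 1, t) = δ₀ (coneChart (r, t))`, `joinCube (r, 0, t) = δ₁ (coneChart (r, t))`.
[folklore] -/
theorem joinCube_insertNth_one (z : Fin (p + 2) → I) {ε : I} (hε : IsExtreme ε) :
    joinCube p (Fin.insertNth (α := fun _ => I) 1 ε z) =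
      stdFace (if ε = 1 then 0 else 1) (coneChart (p + 1) z) := by
  have hz : Fin.insertNth (α := fun _ => I) 1 ε z = Fin.cons (z 0) (Fin.cons ε (Fin.tail z)) := by
    conv_lhs => rw [← Fin.cons_self_tail z]
    rw [show (1 : Fin (p + 3)) = (0 : Fin (p + 2)).succ from rfl, Fin.insertNth_succ_cons,
      Fin.insertNth_zero']
  apply StdSimplex.ext_coe
  rw [coe_joinCube, hz, joinCoord_cons_cons, coe_stdFace, coe_coneChart]
  rcases hε with rfl | rfl
  · rw [if_neg zero_ne_one, show (1 : Fin (p + 4)) = (0 : Fin (p + 3)).succ from rfl,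
      Fin.insertNth_succ_cons, Fin.insertNth_zero']
    simp
  · rw [if_pos rfl, Fin.insertNth_zero']
    simp

/-- Inserting a zero commutes with scaling. [folklore] -/
lemma insertNth_zero_mul {n : ℕ} (J : Fin (n + 1)) (c : ℝ) (v : Fin n → ℝ) :
    (fun i => c * Fin.insertNth (α := fun _ => ℝ) J 0 v i) = Fin.insertNth (α := fun _ => ℝ) J 0 fun i => c * v i := by
  funext i
  cases i using Fin.succAboveCases J with
  | x => simp
  | p l => simp

/-- **The faces `{t_k = 1}` of the join cube `I^{p+4} → Δ^{p+4}` are the join cubes of the facets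
`δ_{k+2}`**: `joinCube (r, e, t with t_k = 1) = δ_{k+2} (joinCube (r, e, t̂ₖ))`. [folklore] -/
theorem joinCube_succ_insertNth_succ_succ_one (k : Fin (p + 2)) (z : Fin (p + 3) → I) :
    joinCube (p + 1) (Fin.insertNth (α := fun _ => I) k.succ.succ 1 z) =
      stdFace k.castSucc.succ.succ (joinCube p z) := by
  have hz : Fin.insertNth (α := fun _ => I) k.succ.succ 1 z =
      Fin.cons (z 0) (Fin.cons (z 1) (Fin.insertNth (α := fun _ => I) k 1 (tail₂ z))) := by
    conv_lhs => rw [eq_cons_cons_tail₂ z]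
    rw [Fin.insertNth_succ_cons, Fin.insertNth_succ_cons]
  apply StdSimplex.ext_coe
  rw [coe_joinCube, hz, joinCoord_cons_cons, coe_stdFace, coe_joinCube, eq_cons_cons_tail₂ z,
    joinCoord_cons_cons, Fin.insertNth_succ_cons, Fin.insertNth_succ_cons, collapse_insertNth_one,
    coe_stdFace, insertNth_zero_mul]
  rfl

/-- **The face `{t_{p+1} = 0}` of the join cube `I^{p+4} → Δ^{p+4}` is the join cube of the last
facet**: `joinCube (r, e, t, 0) = δ_{p+4} (joinCube (r, e, t))`. [folklore] -/
theorem joinCube_succ_insertNth_last_zero (z : Fin (p + 3) → I) :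
    joinCube (p + 1) (Fin.insertNth (α := fun _ => I) (Fin.last (p + 3)) 0 z) =
      stdFace (Fin.last (p + 4)) (joinCube p z) := by
  have hz : Fin.insertNth (α := fun _ => I) (Fin.last (p + 3)) 0 z =
      Fin.cons (z 0) (Fin.cons (z 1) (Fin.insertNth (α := fun _ => I) (Fin.last (p + 1)) 0 (tail₂ z))) := by
    conv_lhs => rw [eq_cons_cons_tail₂ z]
    rw [show Fin.last (p + 3) = (Fin.last (p + 2)).succ from rfl, Fin.insertNth_succ_cons,
      show Fin.last (p + 2) = (Fin.last (p + 1)).succ from rfl, Fin.insertNth_succ_cons]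
  apply StdSimplex.ext_coe
  rw [coe_joinCube, hz, joinCoord_cons_cons, coe_stdFace, coe_joinCube, eq_cons_cons_tail₂ z,
    joinCoord_cons_cons, show Fin.last (p + 4) = (Fin.last (p + 3)).succ from rfl,
    Fin.insertNth_succ_cons, show Fin.last (p + 3) = (Fin.last (p + 2)).succ from rfl,
    Fin.insertNth_succ_cons, collapse_insertNth_last_zero, coe_stdFace, insertNth_zero_mul]
  rfl

/-! ### The lid, the free face and the degenerate strata -/

/-- **The lid `{r = 1}` goes onto the edge `[v₀, v₁]`**: all coordinates beyond the first two
vanish. [folklore] -/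
theorem joinCube_apply_succ_succ_of_lid {y : Fin (p + 3) → I} (hy : y 0 = 1) (k : Fin (p + 2)) :
    ((joinCube p y : StdSimplex (p + 3)) : Fin (p + 4) → ℝ) k.succ.succ = 0 := by
  rw [coe_joinCube, joinCoord_succ_succ, hy]; simp

/-- **The free face `{r = 0}` goes into the codimension-two skeleton** (onto the face
`[v₂, …, v_{p+3}]`: the first two coordinates vanish). [folklore] -/
theorem joinCube_mem_stdSkel_of_free {y : Fin (p + 3) → I} (hy : y 0 = 0) :
    joinCube p y ∈ stdSkel (p + 3) (p + 1) :=
  mem_stdSkel_of_two_eq_zero _ (show (0 : Fin (p + 4)) ≠ 1 from ne_of_beq_false rfl)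
    (by rw [coe_joinCube, joinCoord_zero, hy]; simp) (by rw [coe_joinCube, joinCoord_one, hy]; simp)

/-- A point of `∂I^{p+1}` is collapsed to a point with a vanishing coordinate, hence kills one of the
trailing join coordinates. [folklore] -/
lemma exists_joinCoord_succ_succ_eq_zero {y : Fin (p + 3) → I}
    (hy : tail₂ y ∈ Cube.boundary (Fin (p + 1))) :
    ∃ k : Fin (p + 2), ((joinCube p y : StdSimplex (p + 3)) : Fin (p + 4) → ℝ) k.succ.succ = 0 := by
  obtain ⟨k, hk⟩ := collapse_mem_stdBoundary hy
  exact ⟨k, by rw [coe_joinCube, joinCoord_succ_succ, hk, mul_zero]⟩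

/-- **Points with two extreme coordinates among `e, t` go into the codimension-two skeleton.**
[folklore] -/
theorem joinCube_mem_stdSkel_of_two {y : Fin (p + 3) → I} {i j : Fin (p + 2)} (hij : i ≠ j)
    (hi : IsExtreme (y i.succ)) (hj : IsExtreme (y j.succ)) : joinCube p y ∈ stdSkel (p + 3) (p + 1) := by
  -- an extreme `e` kills `x₀` or `x₁`; an extreme `t_k` puts `t` on `∂I^{p+1}`
  have hE : ∀ {ε : I}, IsExtreme ε → y 1 = ε →
      ∃ a : Fin (p + 4), (a : ℕ) < 2 ∧ ((joinCube p y : StdSimplex (p + 3)) : Fin (p + 4) → ℝ) a = 0 := by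
    rintro ε (rfl | rfl) h1
    · exact ⟨1, by simp, by rw [coe_joinCube, joinCoord_one, h1]; simp⟩
    · exact ⟨0, Nat.zero_lt_two, by rw [coe_joinCube, joinCoord_zero, h1]; simp⟩
  have hT : ∀ k : Fin (p + 1), IsExtreme (y k.succ.succ) → tail₂ y ∈ Cube.boundary (Fin (p + 1)) :=
    fun k hk => ⟨k, hk⟩
  -- case analysis on whether `i`, `j` are the coordinate `e` (index `0` of the block) or trailing
  cases i using Fin.cases with
  | zero =>
    cases j using Fin.cases with
    | zero => exact absurd rfl hij
    | succ l =>
      obtain ⟨a, ha2, ha⟩ := hE hi rfl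
      obtain ⟨k, hk⟩ := exists_joinCoord_succ_succ_eq_zero (hT l hj)
      exact mem_stdSkel_of_two_eq_zero _ (fun h => by
        have := congrArg Fin.val h; simp at this; omega) ha hk
  | succ l =>
    cases j using Fin.cases with
    | zero =>
      obtain ⟨a, ha2, ha⟩ := hE hj rfl
      obtain ⟨k, hk⟩ := exists_joinCoord_succ_succ_eq_zero (hT l hi)
      exact mem_stdSkel_of_two_eq_zero _ (fun h => by
        have := congrArg Fin.val h; simp at this; omega) ha hk
    | succ l' =>
      -- two extreme trailing coordinates: the collapse lies in the codimension-two skeleton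
      have hll' : l ≠ l' := fun h => hij (by rw [h])
      cases p with
      | zero => exact absurd (Fin.ext (by have h1 := l.isLt; have h2 := l'.isLt; omega)) hll'
      | succ p =>
        have hc : collapse (tail₂ y) ∈ stdSkel (p + 2) p := collapse_mem_stdSkel_of_two hll' hi hj
        -- two vanishing coordinates of the collapse
        rw [mem_stdSkel_iff] at hc
        have hcompl : 2 ≤ ((StdSimplex.nzCoords (collapse (tail₂ y)))ᶜ).card := by
          rw [Finset.card_compl, Fintype.card_fin]; omega
        obtain ⟨a, ha, b, hb, hab⟩ := Finset.one_lt_card.1 hcompl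
        rw [Finset.mem_compl, StdSimplex.mem_nzCoords, not_not] at ha hb
        exact mem_stdSkel_of_two_eq_zero _ (fun h => hab (Fin.succ_injective _ (Fin.succ_injective _ h)))
          (by rw [coe_joinCube, joinCoord_succ_succ, ha, mul_zero])
          (by rw [coe_joinCube, joinCoord_succ_succ, hb, mul_zero])

/-- On the face `{t_k = 0}` of the cube, the collapse kills all coordinates beyond `k`. [folklore] -/
lemma collapse_insertNth_zero_apply_of_lt {n : ℕ} (k : Fin (n + 1)) (t' : Fin n → I) {j : Fin (n + 2)}
    (hj : (k : ℕ) < j) : (collapse (Fin.insertNth (α := fun _ => I) k 0 t') : Fin (n + 2) → ℝ) j = 0 := by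
  rw [collapse_apply, pp_insertNth, pp_insertNth, if_neg (by omega), if_neg (by omega)]
  simp

/-- **The degenerate faces `{t_k = 0}`, `k < p`, of the join cube go into the codimension-two
skeleton.** [folklore] -/
theorem joinCube_insertNth_succ_succ_zero_mem_stdSkel (k : Fin (p + 1)) (hk : (k : ℕ) < p)
    (z : Fin (p + 2) → I) :
    joinCube p (Fin.insertNth (α := fun _ => I) k.succ.succ 0 z) ∈ stdSkel (p + 3) (p + 1) := by
  have ht : tail₂ (Fin.insertNth (α := fun _ => I) k.succ.succ 0 z) =
      Fin.insertNth (α := fun _ => I) k 0 (fun i : Fin p => z i.succ.succ) := by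
    have hz : Fin.insertNth (α := fun _ => I) k.succ.succ 0 z =
        Fin.cons (z 0) (Fin.cons (z 1) (Fin.insertNth (α := fun _ => I) k 0 fun i => z i.succ.succ)) := by
      conv_lhs => rw [show z = Fin.cons (z 0) (Fin.cons (z 1) fun i => z i.succ.succ) from by
        funext i
        cases i using Fin.cases with
        | zero => rfl
        | succ j => cases j using Fin.cases with
          | zero => rfl
          | succ l => rfl]
      rw [Fin.insertNth_succ_cons, Fin.insertNth_succ_cons]
    rw [hz]; rfl
  refine mem_stdSkel_of_two_eq_zero _ (a := (⟨k + 1, by omega⟩ : Fin (p + 2)).succ.succ)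
    (b := (⟨k + 2, by omega⟩ : Fin (p + 2)).succ.succ) (fun h => ?_) ?_ ?_
  · have := congrArg Fin.val h; simp at this
  · rw [coe_joinCube, joinCoord_succ_succ, ht, collapse_insertNth_zero_apply_of_lt k _ (by
      show (k : ℕ) < k + 1; omega), mul_zero]
  · rw [coe_joinCube, joinCoord_succ_succ, ht, collapse_insertNth_zero_apply_of_lt k _ (by
      show (k : ℕ) < k + 2; omega), mul_zero]

/-- **The join cube maps `∂I^{p+3}` into `∂Δ^{p+3}`.** [folklore] -/
theorem joinCube_mem_stdBoundary {y : Fin (p + 3) → I} (hy : y ∈ Cube.boundary (Fin (p + 3))) :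
    joinCube p y ∈ stdBoundary (p + 3) := by
  obtain ⟨i, hi⟩ := hy
  cases i using Fin.cases with
  | zero =>
    rcases hi with hi | hi
    · exact ⟨0, by rw [coe_joinCube, joinCoord_zero, hi]; simp⟩
    · exact ⟨(0 : Fin (p + 2)).succ.succ, joinCube_apply_succ_succ_of_lid hi 0⟩
  | succ j =>
    cases j using Fin.cases with
    | zero =>
      rcases hi with hi | hi
      · exact ⟨1, by rw [coe_joinCube, joinCoord_one, show y 1 = 0 from hi]; simp⟩
      · exact ⟨0, by rw [coe_joinCube, joinCoord_zero, show y 1 = 1 from hi]; simp⟩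
    | succ k =>
      obtain ⟨l, hl⟩ := exists_joinCoord_succ_succ_eq_zero (y := y) ⟨k, hi⟩
      exact ⟨l.succ.succ, hl⟩

end Literature.AlgebraicTopology.SingularHomology

end
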